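import Literature.Computability.Complexity.ConstraintGraphGame
import Literature.Computability.Complexity.BipartiteLabelCover
import HarnessLib

/-!
# Regular label cover instances of every soundness error from a regular expanding constraint graph

Topic `Computability/Complexity`, namespace `Literature.Computability.Complexity.Expander.RotGraph`.
The mathematical heart of "`labelcover(1, δ)` is NP-hard for all `δ > 0`" (Dinur–Steurer 2014,
§3.3; Arora–Barak 2009, Thm. 22.15) in the tree's formats: from a `d`-regular rotation graph
`G : RotGraph n d` with dart constraints `C` over `[W]` (the output format of Dinur's preprocessing,
`Expanderize.lean`) to the list-encoded regular projection instances of `LabelCover.lean`.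

* `dartBLC G C W hd` — the dart game of `(G, C)` with the ALIASED alphabet `[W²]`
  (`ConstraintGraphGame.aliasDec`: total projections) as a `Fin`-indexed bipartite instance
  (`BipartiteLabelCover.BLC`); `isoDart` — its game IS the dart game `dartGame G C W aliasDec`
  (an isomorphism of projection games, when every dart has an accepting pair); degrees `2` and `2d`
  (`degB_dartBLC`, `degA_dartBLC`).
* `dartLC G C W hd k : LabelCoverInstance` — **the instance `φ_k`**: the `k`-fold product of `dartBLC`,
  Alice-side blown up by `d^k` (so that both sides have degree `(2d)^k`), rendered as a list; alphabet
  `(W²)^k` (`dartLC_alphabetSize`), well formed, regular (`dartLC_wellFormed`, `dartLC_isRegular`).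
* **`dartLC_mem_yesSet`** — if some assignment with values `< W` satisfies every dart constraint, then
  `φ_k ∈ GapLabelCover.yesSet ((W²)^k)` for every `k` ("if `val(G) = 1` clearly `val(G^{⊗k}) = 1`").
* **`dartLC_mem_noSet`** — if `λ(G) ≤ λ < 1` and every assignment with values `< W` violates at least
  `ε · n d` darts (`ε ≤ 2`), then `φ_k ∈ GapLabelCover.noSet ((W²)^k) ε'` as soon as
  `(1 - ε_DS)^{k/2} < ε'`, `ε_DS = dsEps ((1-λ)/2) (ε/2) > 0` — Dinur–Steurer Thm. 3.4 + Thm. 3.2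
  (`dartGame_pow_valLe`) transported along the isomorphisms `(dartBLC^{⊗k}).game ≅ dartGame^{⊗k}`
  (`ProjectionGameIso.lean`, `BipartiteLabelCover.isoNpow`), then the blow-up and the list rendering
  (`valLe_blowA`, `satCount_toLC_le`).

So for fixed `(λ, ε)` and every target `ε' > 0` a CONSTANT `k` works, the instance `φ_k` has size
polynomial in `n d W` for constant `k`, and what remains for `(gapLabelCover ((W²)^k) ε').IsNPHard` is an
NP-hard family of such `(G, C, W)` with constant `(d, W, λ, ε)` (the PCP theorem in Dinur's form) and
the polynomial-time machine computing the code of `φ_k`.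

## References

* I. Dinur, D. Steurer, *Analytical approach to parallel repetition*, STOC 2014; arXiv:1305.1979,
  §3.3 (Theorem: labelcover(1,δ) is NP-hard for all δ > 0; its proof).
* S. Arora, B. Barak, *Computational Complexity: A Modern Approach*, CUP 2009, Thm. 22.15, §22.3,
  Claim 22.36.
-/

namespace Literature.Computability.Complexity

open Finset

namespace Expander

namespace RotGraph

variable {n d : ℕ} (G : RotGraph n d) (C : Fin n → Fin d → ℕ → ℕ → Bool) (W : ℕ) (hd : 0 < d)

/-! ### The dart instance -/

omit G C W hd in
/-- Decoding an edge index `e < n d 2` into `((v, i), s)`. [folklore] -/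
def edgeEquiv : Fin (n * d * 2) ≃ (Fin n × Fin d) × Fin 2 :=
  finProdFinEquiv.symm.trans (finProdFinEquiv.symm.prodCongr (Equiv.refl _))

omit G C W hd in
/-- `edgeEquiv` spelled out. [folklore] -/
theorem edgeEquiv_apply (e : Fin (n * d * 2)) :
    edgeEquiv e = (finProdFinEquiv.symm (finProdFinEquiv.symm e).1, (finProdFinEquiv.symm e).2) := rfl

/-- **The dart instance of `(G, C)`**: Bob = darts (indexed by `Fin (n d)`) with the aliased alphabet
`[W²]`, Alice = vertices with alphabet `[W]`, the edge `((v,i), s)` (indexed by `Fin (n d 2)`) joins the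
dart to its tail (`s = 0`) or head (`s = 1`) and projects a label, decoded by `aliasDec` into an accepting
pair `(a, b)`, to `a`, resp. `b`. [cite: AroraBarakCC2009, Claim 22.36 and Exercise 22.9] -/
@[reducible] def dartBLC : BLC where
  nB := n * d
  nA := n
  WB := W * W
  WA := W
  m := n * d * 2
  src e := (finProdFinEquiv.symm e).1
  dst e := G.dartEnd (edgeEquiv e)
  proj e u := if (edgeEquiv e).2 = 0 then (aliasDec C W (edgeEquiv e).1 u).1 else (aliasDec C W (edgeEquiv e).1 u).2
  src_surj δ := ⟨finProdFinEquiv (δ, 0), by simp⟩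
  dst_surj u := ⟨finProdFinEquiv (finProdFinEquiv (u, ⟨0, hd⟩), 0), by simp [edgeEquiv_apply, dartEnd]⟩

/-- **The game of the dart instance is the (aliased) dart game**, when every dart has an accepting pair.
[cite: AroraBarakCC2009, Claim 22.36] -/
def isoDart (hacc : ∀ v i, 0 < (accPairs C W v i).length) :
    ProjGame.Iso (G.dartBLC C W hd).game (G.dartGame C W (aliasDec C W) hd) where
  eE := edgeEquiv
  eV := finProdFinEquiv.symm
  eU := Equiv.refl _
  eβ := Equiv.refl _
  eα := Equiv.refl _
  src_eq _ := rfl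
  dst_eq _ := rfl
  proj_eq e u := by
    show dartProj C W (aliasDec C W) (edgeEquiv e) u = (some ((G.dartBLC C W hd).proj e u)).map (Equiv.refl _)
    unfold dartProj
    rw [accept_aliasDec C W (hacc _ _) u, if_pos rfl]
    rfl
  wt_eq _ := rfl

/-- Bob's vertices (darts) have degree `2`. [folklore] -/
theorem degB_dartBLC (δ : Fin (G.dartBLC C W hd).nB) : (G.dartBLC C W hd).degB δ = 2 := by
  unfold BLC.degB
  have h := BLC.card_filter_finProd (fun x : Fin (n * d) => x = δ) (fun _ : Fin 2 => True)
  rw [filter_true, card_univ, Fintype.card_fin, filter_eq', if_pos (mem_univ _), card_singleton, one_mul] at h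
  rw [← h]
  congr 1
  exact filter_congr fun e _ => (iff_of_eq (and_true _)).symm

/-- Alice's vertices have degree `2 d`. [folklore] -/
theorem degA_dartBLC (u : Fin (G.dartBLC C W hd).nA) : (G.dartBLC C W hd).degA u = 2 * d := by
  unfold BLC.degA
  have h1 : ((univ.filter fun e : Fin (n * d * 2) => G.dartEnd (edgeEquiv e) = u).card : ℝ) =
      ((univ.filter fun x : (Fin n × Fin d) × Fin 2 => G.dartEnd x = u).card : ℝ) := by
    exact_mod_cast card_equiv edgeEquiv fun e => by simp only [mem_filter, mem_univ, true_and]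
  have h2 : ((univ.filter fun x : (Fin n × Fin d) × Fin 2 => G.dartEnd x = u).card : ℝ) = 2 * d := by
    rw [natCast_card_filter]
    have h := G.sum_ite_dartEnd (fun _ => (1 : ℝ)) u
    rw [dartOut_const, G.dartIn_const] at h
    rw [h]
    ring
  have h3 : (((univ.filter fun e : Fin (n * d * 2) => G.dartEnd (edgeEquiv e) = u).card : ℕ) : ℝ) = ((2 * d : ℕ) : ℝ) := by
    rw [h1, h2]; push_cast; ring
  exact_mod_cast h3

/-! ### The instances `φ_k` -/

/-- **The label cover instance `φ_k`**: the `k`-fold product of the dart instance, Alice-side blown up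
by `d^k`, as a list-encoded `LabelCoverInstance`. [cite: DinurSteurer2014, §3.3 (G^{⊗k} for k = O(log(1/δ)/ε)); AroraBarakCC2009, §22.3.1 (φ^{*t})] -/
def dartLC (k : ℕ) : LabelCoverInstance :=
  (((G.dartBLC C W hd).npow k).blowA (d ^ k) (pow_pos hd k)).toLC

/-- The alphabet of `φ_k` is `(W²)^k`. [folklore] -/
theorem dartLC_alphabetSize (k : ℕ) : (G.dartLC C W hd k).alphabetSize = (W * W) ^ k := by
  unfold dartLC
  rw [BLC.alphabetSize_toLC]
  exact BLC.WB_npow _ k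

/-- The number of constraints of `φ_k` is `(2 n d)^k d^k`. [folklore] -/
theorem dartLC_numConstraints (k : ℕ) : (G.dartLC C W hd k).numConstraints = (n * d * 2) ^ k * d ^ k := by
  unfold dartLC
  rw [BLC.numConstraints_toLC]
  show ((G.dartBLC C W hd).npow k).m * d ^ k = _
  rw [BLC.m_npow]

/-- The number of variables of `φ_k` is `(n d)^k + n^k d^k`. [folklore] -/
theorem dartLC_numVars (k : ℕ) : (G.dartLC C W hd k).numVars = (n * d) ^ k + n ^ k * d ^ k := by
  unfold dartLC
  rw [BLC.numVars_toLC]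
  show ((G.dartBLC C W hd).npow k).nB + ((G.dartBLC C W hd).npow k).nA * d ^ k = _
  rw [BLC.nB_npow, BLC.nA_npow]

/-- `φ_k` has at least one constraint (`n ≥ 1`). [folklore] -/
theorem dartLC_numConstraints_pos (hn : 0 < n) (k : ℕ) : 0 < (G.dartLC C W hd k).numConstraints := by
  rw [dartLC_numConstraints]
  have : 0 < n * d * 2 := by positivity
  positivity

/-- **`φ_k` is well formed** (`n ≥ 1`). [cite: AroraBarakCC2009, Def. 22.1 and §22.3] -/
theorem dartLC_wellFormed (hn : 0 < n) (k : ℕ) : (G.dartLC C W hd k).WellFormed := by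
  unfold dartLC
  refine BLC.wellFormed_toLC _ ?_ ?_
  · have h := G.dartLC_numConstraints_pos C W hd hn k
    rwa [dartLC, BLC.numConstraints_toLC] at h
  · show ((G.dartBLC C W hd).npow k).WA ≤ ((G.dartBLC C W hd).npow k).WB
    rw [BLC.WA_npow, BLC.WB_npow]
    exact Nat.pow_le_pow_left (Nat.le_mul_self W) k

/-- **`φ_k` is regular**: every variable lies in exactly `(2d)^k` constraints. [cite: AroraBarakCC2009, §22.3 (regular instances); DinurSteurer2014, Claim 8.1] -/
theorem dartLC_isRegular (k : ℕ) : (G.dartLC C W hd k).IsRegular := by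
  unfold dartLC
  refine BLC.isRegular_toLC _ (D := (2 * d) ^ k) (fun v => ?_) (fun u => ?_)
  · rw [BLC.degB_blowA, BLC.degB_npow _ (G.degB_dartBLC C W hd) k v, ← mul_pow]
  · rw [BLC.degA_blowA, BLC.degA_npow _ (G.degA_dartBLC C W hd) k]

/-- The game of `dartBLC^{⊗k}` is isomorphic to `dartGame^{⊗k}`. [cite: DinurSteurer2014, §2.2] -/
def isoNpowDart (hacc : ∀ v i, 0 < (accPairs C W v i).length) (k : ℕ) :
    ProjGame.Iso ((G.dartBLC C W hd).npow k).game ((G.dartGame C W (aliasDec C W) hd).pow k) :=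
  ((G.dartBLC C W hd).isoNpow k).trans ((G.isoDart C W hd hacc).pow k)

/-- **Completeness: `φ_k` is a YES instance** of `gapLabelCover ((W²)^k) ·` whenever `(G, C)` is satisfied
by an assignment with values `< W` (and every dart has an accepting pair, e.g. because of that).
[cite: DinurSteurer2014, §3.3 ("If val(G) = 1 clearly val(G^{⊗k}) = 1")] -/
theorem dartLC_mem_yesSet (hn : 0 < n) (hacc : ∀ v i, 0 < (accPairs C W v i).length)
    {σ : Fin n → ℕ} (hσ : ∀ u, σ u < W) (hsat : ∀ v i, C v i (σ v) (σ (G.nbr v i)) = true) (k : ℕ) :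
    G.dartLC C W hd k ∈ GapLabelCover.yesSet ((W * W) ^ k) := by
  refine ⟨G.dartLC_wellFormed C W hd hn k, G.dartLC_alphabetSize C W hd k, G.dartLC_isRegular C W hd k, ?_⟩
  -- perfect strategies for the repeated dart game, transported to the list instance
  obtain ⟨bk, ak, hk⟩ := G.dartGame_pow_sat C W (aliasDec C W) hd (exists_aliasDec_eq C W) hσ hsat k
  obtain ⟨b, a, hba⟩ := (G.isoNpowDart C W hd hacc k).sat_iff.2 ⟨bk, ak, hk⟩
  rw [BLC.game_sat_iff] at hba
  exact BLC.isSatisfiable_toLC _ (b := b) (a := fun u => a (finProdFinEquiv.symm u).1)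
    (BLC.sat_blowA _ (d ^ k) (pow_pos hd k) hba)

/-- **Soundness: `φ_k` is a NO instance** of `gapLabelCover ((W²)^k) ε'` whenever `λ(G) ≤ λ < 1`, every
assignment with values `< W` violates at least `ε · n d` darts (`ε ≤ 2`), every dart has an accepting pair,
and `k` is large enough that `(1 - ε_DS)^{k/2} < ε'`. [cite: DinurSteurer2014, §3.3 (val(G^{⊗k}) ≤ (1 - Ω(ε))^k ≤ δ)] -/
theorem dartLC_mem_noSet (hn : 0 < n) (hacc : ∀ v i, 0 < (accPairs C W v i).length)
    {lam ε : ℝ} (hlam : SpectralBound G.walkMatrix lam) (hlam1 : lam < 1) (hε2 : ε ≤ 2)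
    (hε : ∀ σ : Fin n → ℕ, (∀ u, σ u < W) →
      ε * (n * d) ≤ ((univ.filter fun x : Fin n × Fin d => C x.1 x.2 (σ x.1) (σ (G.nbr x.1 x.2)) = false).card : ℝ))
    (k : ℕ) {ε' : ℝ} (hk : Real.sqrt (1 - ProjGame.dsEps ((1 - lam) / 2) (ε / 2)) ^ k < ε') :
    G.dartLC C W hd k ∈ GapLabelCover.noSet ((W * W) ^ k) ε' := by
  refine ⟨G.dartLC_wellFormed C W hd hn k, G.dartLC_alphabetSize C W hd k, G.dartLC_isRegular C W hd k, fun x => ?_⟩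
  set θ := Real.sqrt (1 - ProjGame.dsEps ((1 - lam) / 2) (ε / 2)) ^ k with hθ
  have hθ0 : 0 ≤ θ := pow_nonneg (Real.sqrt_nonneg _) k
  -- the value bound on the repeated dart game, transported
  have hpow := G.dartGame_pow_valLe C W (aliasDec C W) hd hn hlam hlam1 hε2 hε k
  have hnpow : ((G.dartBLC C W hd).npow k).game.ValLe θ := ((G.isoNpowDart C W hd hacc k).valLe_iff θ).2 hpow
  have hblow := BLC.valLe_blowA _ (d ^ k) (pow_pos hd k) hnpow
  have hcount := BLC.satCount_toLC_le _ hθ0 hblow x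
  have hm : (0 : ℝ) < (G.dartLC C W hd k).numConstraints := by exact_mod_cast G.dartLC_numConstraints_pos C W hd hn k
  unfold dartLC at hm ⊢
  rw [BLC.numConstraints_toLC] at hm ⊢
  calc (((((G.dartBLC C W hd).npow k).blowA (d ^ k) (pow_pos hd k)).toLC.satCount x : ℕ) : ℝ)
      ≤ θ * ((((G.dartBLC C W hd).npow k).blowA (d ^ k) (pow_pos hd k)).m : ℕ) := hcount
    _ < ε' * ((((G.dartBLC C W hd).npow k).blowA (d ^ k) (pow_pos hd k)).m : ℕ) := mul_lt_mul_of_pos_right hk hm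

/-- **The exponent needed for a target soundness error exists**: since `0 ≤ √(1 - ε_DS) < 1`, for every
`ε' > 0` some `k` has `√(1 - ε_DS)^k < ε'`. [cite: DinurSteurer2014, §3.3 (k = O(log(1/δ)/ε))] -/
theorem exists_pow_lt {lam ε ε' : ℝ} (hlam1 : lam < 1) (hε : 0 < ε) (hε' : 0 < ε') :
    ∃ k : ℕ, Real.sqrt (1 - ProjGame.dsEps ((1 - lam) / 2) (ε / 2)) ^ k < ε' :=
  exists_pow_lt_of_lt_one hε' (sqrt_one_sub_dsEps_lt_one hlam1 hε)

end RotGraph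

end Expander

end Literature.Computability.Complexity
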